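import Summits.ResolutionOfSingularities.ResolutionOfSingularities.Theorems.HomologicalConductorNoZenoMinResolutionFewest
import Summits.ResolutionOfSingularities.ResolutionOfSingularities.Theorems.HomologicalConductorNoZenoSepClosedTower
import Summits.ResolutionOfSingularities.ResolutionOfSingularities.Theorems.HomologicalConductorNoZenoSplitWeightFinite
import Literature.AlgebraicGeometry.Resolution.ExceptionalCurvePoints
import HarnessLib

/-!
# Crux `NoZenoR` / `NoZeno` (stmt-ResolutionOfSingularities-19943 / -16483) — slot 5 (B1) closer, (W-up): THE SPLIT WEIGHT OF AN OLD
# CURVE OF THE GERM RESOLUTION IS ONE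

Route `ResolutionOfSingularities/HomologicalConductor`, W4.4 chain, slot 5 `stub_L1wCoreF3` (res-L0-w44-plan-1 DESK WORD 22/23 «(W-up) stays with
stub-3, second object after `Seam1Package`»; res-L0-w44-lead-1 INTERFACE 21:13:10Z binder
`hw : ∀ y ∈ excCurvePoints ψ, gW y ∉ NEW → splitWeight ψ y ≤ splitWeight π (ρ (gW y))` of `hasSplitExcCurveCountLE_pred_routeM`).

SETTING (the outputs of `exists_seam1Package`, p573278): `π : X → Spec S` and `ρ ≫ π : X¹ → Spec S` resolutions of the two-dimensional
Noetherian local domain `S`, the germ resolution `ψ : W → Spec S′`, the comparison map `gW : W → X¹` (a local isomorphism) and the square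
`gW ≫ ρ ≫ π = ψ ≫ Spec f` for the structure map `f : S → S′`.  For a curve `y` of `ψ` whose image `gW y` is an OLD curve (`ρ (gW y)` is a
curve of `π`) of split weight one — upstairs, after the split-base transfer, every curve of `π` has split weight one (BC-2c) — the split
weight of `y` over `S′` is one as well, PROVIDED the residue field of `S′` is algebraic over that of `S` (binder `halg`, the one geometric
input: the new centre is a closed point).  Field-theoretically (`sepDegree_eq_one_of_isAlgebraic`): in the tower
`κ_S → κ_{S′} → κ(y) ≅ κ(gW y) ≅ κ(ρ gW y)` the bottom field is separably closed in the top one (weight one + FW finiteness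
`finiteDimensional_separableClosure_residueField`, res-L1-type-o5 p547324), and `κ_{S′}/κ_S` is algebraic, so `κ_{S′}` is separably closed in
`κ(y)` (`finrank_separableClosure_eq_one_of_isAlgebraic`, p557965).  The residue-field identifications are `splitWeight_eq_of_fac` (DOM, along `ρ`)
and `splitWeight_comp_eq_of_stalkMap_bijective` (along the local isomorphism `gW`); the square is crossed by `subst` lemmas
(`splitWeight_congr_hom`, `finiteDimensional_separableClosure_congr_hom`, `…_congr_algebraMap`, `isAlgebraic_residueFieldMap_congr_pt`).

Def-free, fact-free; `--supports 19943 --as helper`.  OURS (cell res-hironaka): AI-produced and kernel-checked, weaker than expert review;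
nothing here is a statement of the manuscript under review (Hironaka 2017); counted 0.
-/

noncomputable section

-- single-problem summit: the doubled namespace component `ResolutionOfSingularities` is forced
set_option linter.dupNamespace false

open CategoryTheory AlgebraicGeometry TopologicalSpace IsLocalRing
open Literature.AlgebraicGeometry.Resolution

namespace Summit.ResolutionOfSingularities.ResolutionOfSingularities.Theorems.NoZeno.ExcCount

/-! ## §1 The field-theoretic core -/

/-- **Separable degree one descends to an algebraic intermediate base.**  For field maps `a : F → E`, `b : E → L` with `E/F`
algebraic and the separable closure of `F` in `L` finite-dimensional: `sepDegree (b ∘ a) = 1 ⇒ sepDegree b = 1`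
(`finrank_separableClosure_eq_one_of_isAlgebraic`). [folklore] -/
theorem sepDegree_eq_one_of_isAlgebraic {F E L : Type*} [Field F] [Field E] [Field L] (a : F →+* E) (b : E →+* L)
    (halg : letI := a.toAlgebra; Algebra.IsAlgebraic F E)
    (hfin : letI := (b.comp a).toAlgebra; FiniteDimensional F (separableClosure F L))
    (h1 : sepDegree (b.comp a) = 1) : sepDegree b = 1 := by
  letI : Algebra F E := a.toAlgebra
  letI : Algebra E L := b.toAlgebra
  letI : Algebra F L := (b.comp a).toAlgebra
  haveI : IsScalarTower F E L := IsScalarTower.of_algebraMap_eq fun _ => rfl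
  haveI := halg
  haveI := hfin
  have hpos : 1 ≤ Module.finrank F (separableClosure F L) := Module.finrank_pos
  have hF : Module.finrank F (separableClosure F L) = 1 := by
    unfold sepDegree at h1
    rw [max_eq_right hpos] at h1
    exact h1
  have hE := finrank_separableClosure_eq_one_of_isAlgebraic (F := F) (E := E) (K := L) hF
  unfold sepDegree
  rw [hE, max_self]

/-- Transport of the finiteness of the separable closure along an equality of structure maps. [folklore] -/
theorem finiteDimensional_separableClosure_congr_algebraMap {F L : Type*} [Field F] [Field L] {i₁ i₂ : F →+* L}
    (h : i₁ = i₂) (hfin : letI := i₁.toAlgebra; FiniteDimensional F (separableClosure F L)) :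
    letI := i₂.toAlgebra; FiniteDimensional F (separableClosure F L) := by
  subst h
  exact hfin

/-! ## §2 Split weights along a local isomorphism and along an equality of structure morphisms -/

section Scheme

variable {S : Type} [CommRing S] {W X1 : Scheme.{0}} (π1 : X1 ⟶ Spec (.of S)) (g : W ⟶ X1) (y : W)

/-- **Split weights do not change along a local isomorphism**: if `g.stalkMap y` is bijective then
`splitWeight (g ≫ π₁) y = splitWeight π₁ (g y)` (the residue fields `κ(g y) ≅ κ(y)` are isomorphic over `κ(π₁ g y)`;
`sepDegree_comp_ringEquiv`). [folklore] -/
theorem splitWeight_comp_eq_of_stalkMap_bijective (hbij : Function.Bijective (g.stalkMap y).hom) :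
    splitWeight (g ≫ π1) y = splitWeight π1 (g.base y) := by
  rw [splitWeight_eq_sepDegree, splitWeight_eq_sepDegree]
  have hcomp : ((g ≫ π1).residueFieldMap y).hom =
      (g.residueFieldMap y).hom.comp (π1.residueFieldMap (g.base y)).hom := by
    rw [Scheme.residueFieldMap_comp]
    rfl
  rw [hcomp]
  let e : X1.presheaf.stalk (g.base y) ≃+* W.presheaf.stalk y := RingEquiv.ofBijective (g.stalkMap y).hom hbij
  let ψ : X1.residueField (g.base y) ≃+* W.residueField y := IsLocalRing.ResidueField.mapEquiv e
  have hψ : (g.residueFieldMap y).hom = ψ.toRingHom := RingHom.ext fun x => rfl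
  rw [hψ]
  exact sepDegree_comp_ringEquiv _ ψ

/-- **FW along a local isomorphism**: for `π₁` locally of finite type and `g.stalkMap y` bijective, the separable closure of
`κ(π₁ g y)` in `κ(y)` — through `(g ≫ π₁).residueFieldMap y` — is finite-dimensional (it is isomorphic to the one in `κ(g y)`,
finite by `finiteDimensional_separableClosure_residueField`). [folklore] -/
theorem finiteDimensional_separableClosure_comp_of_stalkMap_bijective [LocallyOfFiniteType π1]
    (hbij : Function.Bijective (g.stalkMap y).hom) :
    letI := ((g ≫ π1).residueFieldMap y).hom.toAlgebra
    FiniteDimensional ((Spec (.of S)).residueField ((g ≫ π1).base y))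
      (separableClosure ((Spec (.of S)).residueField ((g ≫ π1).base y)) (W.residueField y)) := by
  letI algL : Algebra ((Spec (.of S)).residueField (π1.base (g.base y))) (W.residueField y) :=
    ((g ≫ π1).residueFieldMap y).hom.toAlgebra
  letI algE : Algebra ((Spec (.of S)).residueField (π1.base (g.base y))) (X1.residueField (g.base y)) :=
    (π1.residueFieldMap (g.base y)).hom.toAlgebra
  haveI := finiteDimensional_separableClosure_residueField π1 (g.base y)
  let e : X1.presheaf.stalk (g.base y) ≃+* W.presheaf.stalk y := RingEquiv.ofBijective (g.stalkMap y).hom hbij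
  let ψ : X1.residueField (g.base y) ≃+* W.residueField y := IsLocalRing.ResidueField.mapEquiv e
  have hψ : (g.residueFieldMap y).hom = ψ.toRingHom := RingHom.ext fun x => rfl
  have hcomp : ((g ≫ π1).residueFieldMap y).hom =
      ψ.toRingHom.comp (π1.residueFieldMap (g.base y)).hom := by
    rw [Scheme.residueFieldMap_comp, ← hψ]
    rfl
  let ψₐ : X1.residueField (g.base y) ≃ₐ[(Spec (.of S)).residueField (π1.base (g.base y))] W.residueField y :=
    { ψ with
      commutes' := fun r => by
        change ψ ((π1.residueFieldMap (g.base y)).hom r) = ((g ≫ π1).residueFieldMap y).hom r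
        rw [hcomp]
        rfl }
  exact (separableClosure.algEquivOfAlgEquiv ψₐ).toLinearEquiv.finiteDimensional

variable {π1 g y}

/-- Split weights along equal structure morphisms agree (`subst`). [folklore] -/
theorem splitWeight_congr_hom {m m' : W ⟶ Spec (.of S)} (h : m = m') (w : W) : splitWeight m w = splitWeight m' w := by
  subst h
  rfl

/-- Transport of FW along an equality of structure morphisms (`subst`). [folklore] -/
theorem finiteDimensional_separableClosure_congr_hom {m m' : W ⟶ Spec (.of S)} (h : m = m') (w : W)
    (hfin : letI := (m.residueFieldMap w).hom.toAlgebra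
      FiniteDimensional ((Spec (.of S)).residueField (m.base w))
        (separableClosure ((Spec (.of S)).residueField (m.base w)) (W.residueField w))) :
    letI := (m'.residueFieldMap w).hom.toAlgebra
    FiniteDimensional ((Spec (.of S)).residueField (m'.base w))
      (separableClosure ((Spec (.of S)).residueField (m'.base w)) (W.residueField w)) := by
  subst h
  exact hfin

/-- Transport of residue-field algebraicity along an equality of points (`subst`). [folklore] -/
theorem isAlgebraic_residueFieldMap_congr_pt {S' : Type} [CommRing S'] (f : S →+* S') {p p' : Spec (.of S')}
    (h : p = p')
    (halg : letI := ((Spec.map (CommRingCat.ofHom f)).residueFieldMap p).hom.toAlgebra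
      Algebra.IsAlgebraic ((Spec (.of S)).residueField ((Spec.map (CommRingCat.ofHom f)).base p))
        ((Spec (.of S')).residueField p)) :
    letI := ((Spec.map (CommRingCat.ofHom f)).residueFieldMap p').hom.toAlgebra
    Algebra.IsAlgebraic ((Spec (.of S)).residueField ((Spec.map (CommRingCat.ofHom f)).base p'))
      ((Spec (.of S')).residueField p') := by
  subst h
  exact halg

end Scheme

/-! ## §3 (W-up) -/

section WeightUp

variable {S S' : Type} [CommRing S] [IsNoetherianRing S] [IsDomain S] [IsLocalRing S] [CommRing S'] [IsLocalRing S']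
  {X X1 W : Scheme.{0}} {π : X ⟶ Spec (.of S)} (ρ : X1 ⟶ X) (ψ : W ⟶ Spec (.of S')) (gW : W ⟶ X1) (f : S →+* S')

/-- **(W-up) THE SPLIT WEIGHT OF AN OLD CURVE OF THE GERM RESOLUTION IS ONE.**  Let `π : X → Spec S` and `ρ ≫ π : X¹ → Spec S` be
resolutions of the two-dimensional Noetherian local domain `S`, `ψ : W → Spec S′`, `gW : W → X¹`, `f : S → S′` with
`gW ≫ ρ ≫ π = ψ ≫ Spec f` (the square of `exists_seam1Package`), and assume the residue field of `S′` is ALGEBRAIC over that of `S`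
(`halg`).  If `y ∈ W` lies over the closed point of `S′`, `gW` is a local isomorphism at `y`, `ρ (gW y)` is an integral exceptional
curve of `π` and `splitWeight π (ρ (gW y)) = 1`, then `splitWeight ψ y = 1`. [cite: Lipman1969, §16 (16.1) (p. 231)] -/
theorem splitWeight_eq_one_of_sq (h2 : ringKrullDim S = 2) (hπ : IsResolution π) (hψ1 : IsResolution (ρ ≫ π))
    (hsq : gW ≫ ρ ≫ π = ψ ≫ Spec.map (CommRingCat.ofHom f))
    (halg : letI := ((Spec.map (CommRingCat.ofHom f)).residueFieldMap (closedPoint S')).hom.toAlgebra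
      Algebra.IsAlgebraic ((Spec (.of S)).residueField ((Spec.map (CommRingCat.ofHom f)).base (closedPoint S')))
        ((Spec (.of S')).residueField (closedPoint S')))
    {y : W} (hy : ψ.base y = closedPoint S') (hiso : Function.Bijective (gW.stalkMap y).hom)
    (hold : ρ.base (gW.base y) ∈ excCurvePoints π) (h1 : splitWeight π (ρ.base (gW.base y)) = 1) :
    splitWeight ψ y = 1 := by
  haveI : IsProper (ρ ≫ π) := hψ1.isProper
  -- the weight along `gW ≫ ρ ≫ π` is one
  have hw1 : splitWeight (gW ≫ ρ ≫ π) y = 1 := by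
    rw [splitWeight_comp_eq_of_stalkMap_bijective (ρ ≫ π) gW y hiso, splitWeight_eq_of_fac h2 hψ1 hπ hold, h1]
  have hfin := finiteDimensional_separableClosure_comp_of_stalkMap_bijective (ρ ≫ π) gW y hiso
  -- cross the square
  have hw2 : splitWeight (ψ ≫ Spec.map (CommRingCat.ofHom f)) y = 1 := by
    rw [← splitWeight_congr_hom hsq y, hw1]
  have hfin2 := finiteDimensional_separableClosure_congr_hom hsq y hfin
  -- decompose the residue field map of `ψ ≫ Spec f` at `y`
  have hcomp : ((ψ ≫ Spec.map (CommRingCat.ofHom f)).residueFieldMap y).hom =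
      (ψ.residueFieldMap y).hom.comp ((Spec.map (CommRingCat.ofHom f)).residueFieldMap (ψ.base y)).hom := by
    rw [Scheme.residueFieldMap_comp]
    rfl
  rw [splitWeight_eq_sepDegree, hcomp] at hw2
  have hfin3 := finiteDimensional_separableClosure_congr_algebraMap hcomp hfin2
  rw [splitWeight_eq_sepDegree]
  exact sepDegree_eq_one_of_isAlgebraic _ _ (isAlgebraic_residueFieldMap_congr_pt f hy.symm halg) hfin3 hw2

/-- **(W-up), the binder `hw` of `hasSplitExcCurveCountLE_pred_routeM`**: under the same hypotheses
`splitWeight ψ y ≤ splitWeight π (ρ (gW y))`. [cite: Lipman1969, §16 (16.1) (p. 231)] -/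
theorem splitWeight_le_of_sq (h2 : ringKrullDim S = 2) (hπ : IsResolution π) (hψ1 : IsResolution (ρ ≫ π))
    (hsq : gW ≫ ρ ≫ π = ψ ≫ Spec.map (CommRingCat.ofHom f))
    (halg : letI := ((Spec.map (CommRingCat.ofHom f)).residueFieldMap (closedPoint S')).hom.toAlgebra
      Algebra.IsAlgebraic ((Spec (.of S)).residueField ((Spec.map (CommRingCat.ofHom f)).base (closedPoint S')))
        ((Spec (.of S')).residueField (closedPoint S')))
    {y : W} (hy : ψ.base y = closedPoint S') (hiso : Function.Bijective (gW.stalkMap y).hom)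
    (hold : ρ.base (gW.base y) ∈ excCurvePoints π) (h1 : splitWeight π (ρ.base (gW.base y)) = 1) :
    splitWeight ψ y ≤ splitWeight π (ρ.base (gW.base y)) := by
  rw [splitWeight_eq_one_of_sq ρ ψ gW f h2 hπ hψ1 hsq halg hy hiso hold h1, h1]

end WeightUp

end Summit.ResolutionOfSingularities.ResolutionOfSingularities.Theorems.NoZeno.ExcCount

end
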